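import Literature.AlgebraicGeometry.Motives.HodgeLieWeightOneSl2Center
import HarnessLib

/-!
# Weight-one Hodge structures whose Hodge Lie algebra has a three-dimensional derived algebra and ARBITRARY centre.
# B: `[E, F] = α(2P−1) + ζ₀` with `α ≠ 0`, `ζ₀ ∈ 𝔷_ℂ`; `𝔥_ℂ = ℂ(2P−1) ⊕ ℂE ⊕ ℂF ⊕ 𝔷_ℂ`; `ζ₀ E = ζ₀ F = 0`

Family `hodge`, layer `Literature/AlgebraicGeometry/Motives`; THEOREMS ONLY (no definition, no named fact; D-0026).
Second abstract file of the lane MT-RANK-SIX-ISOGENY of the cell `pub-hodgecm2` (COR-CM), seat `b27` (setting as in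
`Motives/HodgeLieWeightOneSl2Center`: polarizable weight-one `H` with polarization `ψ`, graded basis `e` with degrees in
`{0,1}`, `P = gradingEnd e deg`, `X ∈ 𝔥 ∖ End_Hdg(V)`, `E = P X_ℂ (1 − P)`, `F = (1 − P) X_ℂ P`, `𝔷 = 𝔥 ∩ End_Hdg(V)`,
`𝔡 = span_ℚ {[X₁, X₂] | Xᵢ ∈ 𝔥}` with `dim_ℚ 𝔡 = 3`).

* §2 `exists_commutator_eq_of_finrank_derived_eq_three` — **`[E, F] = α(2P − 1) + ζ₀` with `α ≠ 0`, `ζ₀ ∈ 𝔷_ℂ`**: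
  `2P − 1 ∈ 𝔥_ℂ = 𝔷_ℂ + 𝔡_ℂ` (`𝔥 = 𝔷 ⊕ 𝔡`, `Motives/HodgeThetaSubalgebraReductive`) has no `E`- and no `F`-component,
  and its `[E,F]`-component is non-zero because an element of `𝔷_ℂ` commutes with `E` while `[2P − 1, E] = 2E ≠ 0`;
  consequently **`𝔥_ℂ = ℂ(2P−1) ⊕ ℂE ⊕ ℂF ⊕ 𝔷_ℂ`** (`exists_coeffs_center_of_mem_hodgeLieC`, uniqueness
  `coeffs_center_eq_zero`).
* §3 `corners_of_commutator_eq` — **`E F = αP + ζ₀P`, `F E = α(1−P) − ζ₀(1−P)`, `ζ₀ E = 0 = ζ₀ F`,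
  `E F + F E = α + ζ₀(2P−1)`** (`E F E` computed in two ways gives `2ζ₀E = 0`, as in the `dim 𝔷 = 1` file
  `Motives/HodgeLieWeightOneRankFourSplitting`).

Classically (Moonen–Zarhin 1999 §2, Deligne LNM 900 I §3): `Hg⁰ = SL₂ · Z` with `Z` a torus of Hodge endomorphisms and
`Lie(SL₂)_ℂ = ⟨2P − 1 + ζ₀/α, E, F⟩`; the sequel `Motives/HodgeLieWeightOneSl2CenterSplitting` proves that `Z` acts
trivially where `SL₂` acts non-trivially.

## References

* [MoonenZarhin1999LowDim] B. Moonen, Yu. Zarhin, *Hodge classes on abelian varieties of low dimension*, Math. Ann. 315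
  (1999), §2 (Hodge group, reductivity, `End⁰(X) = End_{Hg} H¹`).
* [Deligne1982HodgeCycles] P. Deligne, *Hodge cycles on abelian varieties*, LNM 900 (1982), I §3 (3.1–3.6).
* [FultonHarris1991] W. Fulton, J. Harris, *Representation Theory*, GTM 129 (1991), Lecture 11 (§11.1), §9.3.
-/

noncomputable section

open scoped TensorProduct

namespace Literature.AlgebraicGeometry.Motives

universe u

namespace HodgeStructure

open ProjectorBlocks Literature.RepresentationTheory.GeneralLinear

variable {V : Type u} [AddCommGroup V] [Module ℚ V] [Module.Finite ℚ V] [HodgeTensorFacts.{u, u}] {n : ℤ}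
  {S : Type u} [Fintype S] [DecidableEq S] {deg : S → ℤ}

/-! ## §2 `[E, F] = α(2P − 1) + ζ₀` with `α ≠ 0`, `ζ₀ ∈ 𝔷_ℂ`; `𝔥_ℂ = ℂ(2P−1) ⊕ ℂE ⊕ ℂF ⊕ 𝔷_ℂ` -/

/-- **`[E, F] = α(2P − 1) + ζ₀` with `α ≠ 0` and `ζ₀ ∈ 𝔷_ℂ`** (`𝔷 = 𝔥 ∩ End_Hdg(V)`; weight `1`, effective, `ψ` a
polarization, `X ∈ 𝔥 ∖ End_Hdg(V)`, `dim_ℚ 𝔡 = 3`).  Since `𝔥 = 𝔷 ⊕ 𝔡` (`hodgeLie_center_sup_derived_eq`),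
`2P − 1 = ζ' + c₀E + c₁F + c₂[E,F]` with `ζ' ∈ 𝔷_ℂ`; the off-diagonal blocks give `c₀ = c₁ = 0` (`ζ'` commutes with
`P`), and `c₂ = 0` would make `2P − 1 = ζ'` commute with `E`, against `[2P − 1, E] = 2E ≠ 0`.  So
`[E, F] = c₂⁻¹(2P − 1) − c₂⁻¹ζ'`. [cite: MoonenZarhin1999LowDim, §2] [cite: Deligne1982HodgeCycles, I §3 (3.1–3.6)]
[cite: FultonHarris1991, Lecture 11 (§11.1)] -/
theorem exists_commutator_eq_of_finrank_derived_eq_three (H : HodgeStructure V n) (ψ : H.Polarization) (hn : n = 1)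
    (heff : H.IsEffective) (e : Module.Basis S ℂ (ℂ ⊗[ℚ] V)) (hF : ∀ a, H.F a = Submodule.span ℂ (e '' {σ | a ≤ deg σ}))
    (hFc : ∀ a, complexConj (H.F a) = Submodule.span ℂ (e '' {σ | deg σ ≤ n - a}))
    (hdeg : ∀ σ, deg σ = 0 ∨ deg σ = 1) {X : Module.End ℚ V} (hX : X ∈ H.hodgeLie) (hXE : X ∉ H.endAlg)
    (h3 : Module.finrank ℚ ↥(Submodule.span ℚ {B | ∃ X ∈ H.hodgeLie, ∃ Y ∈ H.hodgeLie, X * Y - Y * X = B}) = 3) :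
    ∃ (α : ℂ) (ζ₀ : Module.End ℂ (ℂ ⊗[ℚ] V)), α ≠ 0 ∧ ζ₀ ∈ spanC (H.hodgeLie ⊓ Subalgebra.toSubmodule H.endAlg) ∧
      (gradingEnd e deg * X.baseChange ℂ * (1 - gradingEnd e deg)) *
          ((1 - gradingEnd e deg) * X.baseChange ℂ * gradingEnd e deg) -
        ((1 - gradingEnd e deg) * X.baseChange ℂ * gradingEnd e deg) *
          (gradingEnd e deg * X.baseChange ℂ * (1 - gradingEnd e deg)) =
        α • ((2 : ℂ) • gradingEnd e deg - 1) + ζ₀ := by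
  classical
  subst hn
  set 𝔡 := Submodule.span ℚ {B | ∃ X ∈ H.hodgeLie, ∃ Y ∈ H.hodgeLie, X * Y - Y * X = B} with h𝔡
  set 𝔷 := H.hodgeLie ⊓ Subalgebra.toSubmodule H.endAlg with h𝔷
  obtain ⟨hE0, hF0⟩ := projE_ne_zero_of_not_mem_endAlg H rfl e hF hFc hdeg hXE
  set P := gradingEnd e deg with hP
  set Y := X.baseChange ℂ with hY
  set E := P * Y * (1 - P) with hEdef
  set F := (1 - P) * Y * P with hFdef
  have hPP : P * P = P := gradingEnd_mul_gradingEnd_of_deg e hdeg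
  have hPE : P * E = E := by rw [hEdef, ← mul_assoc, ← mul_assoc, hPP]
  have hEP : E * P = 0 := by rw [hEdef, mul_assoc (P * Y) (1 - P) P, sub_mul, one_mul, hPP, sub_self, mul_zero]
  have hPF : P * F = 0 := by
    rw [hFdef, mul_assoc (1 - P) Y P, ← mul_assoc P (1 - P) (Y * P), mul_sub, mul_one, hPP, sub_self, zero_mul]
  have hFP : F * P = F := by rw [hFdef, mul_assoc ((1 - P) * Y) P P, hPP]
  have hEQ : E * (1 - P) = E := by rw [mul_sub, mul_one, hEP, sub_zero]
  have hQF : (1 - P) * F = F := by rw [sub_mul, one_mul, hPF, sub_zero]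
  have hYM : Y ∈ H.hodgeLieC := H.baseChange_mem_hodgeLieC hX
  obtain ⟨hEM, hFM⟩ := projE_mem_hodgeLieC H e hF hFc hdeg hYM
  rw [← hP, ← hEdef] at hEM
  rw [← hP, ← hFdef] at hFM
  have hΘ' : (2 : ℂ) • P - 1 ∈ H.hodgeLieC := by
    simpa only [Int.cast_one, one_smul] using two_smul_gradingEnd_sub_mem_hodgeLieC H e hF hFc
  have hPB : P * (E * F - F * E) = E * F := by
    rw [mul_sub, ← mul_assoc P E F, ← mul_assoc P F E, hPE, hPF, zero_mul, sub_zero]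
  have hBP : (E * F - F * E) * P = E * F := by
    rw [sub_mul, mul_assoc E F P, mul_assoc F E P, hFP, hEP, mul_zero, sub_zero]
  -- `2P − 1 ∈ 𝔷_ℂ + 𝔡_ℂ`
  have hsum : H.hodgeLieC = spanC 𝔷 ⊔ spanC 𝔡 := by
    rw [hodgeLieC_eq_spanC, ← spanC_sup, h𝔷, h𝔡, hodgeLie_center_sup_derived_eq H rfl heff ψ]
  have hΘ'' := hΘ'
  rw [hsum, Submodule.mem_sup] at hΘ''
  obtain ⟨ζ', hζ', D, hD, hΘD⟩ := hΘ''
  obtain ⟨c, hc⟩ := exists_coeffs_of_mem_spanC_derived H ψ rfl e hF hFc hdeg hX hXE h3 hD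
  rw [← hP, ← hY, ← hEdef, ← hFdef] at hc
  have hζ'P : ζ' * P = P * ζ' := commute_gradingEnd_of_mem_spanC_center H rfl e hF hFc hζ'
  have hζ'E : ζ' * E = E * ζ' := commute_of_mem_spanC_center H hζ' hEM
  -- the `(+)`-block: `c 0 = 0`
  have hc0 : c 0 = 0 := by
    have h : P * (ζ' + D) * (1 - P) = P * ((2 : ℂ) • P - 1) * (1 - P) := by rw [hΘD]
    rw [(blocks_theta hPP).1, mul_add, add_mul, (blocks_D hPP hζ'P).1, zero_add, hc, mul_add, mul_add, add_mul,
      add_mul, mul_smul_comm, mul_smul_comm, mul_smul_comm, smul_mul_assoc, smul_mul_assoc, smul_mul_assoc, hPE, hEQ,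
      hPF, zero_mul, smul_zero, add_zero, hPB, mul_assoc E F (1 - P), mul_sub F 1 P, mul_one, hFP, sub_self, mul_zero,
      smul_zero, add_zero] at h
    exact (smul_eq_zero.1 h).resolve_right hE0
  -- the `(−)`-block: `c 1 = 0`
  have hc1 : c 1 = 0 := by
    have h : (1 - P) * (ζ' + D) * P = (1 - P) * ((2 : ℂ) • P - 1) * P := by rw [hΘD]
    rw [(blocks_theta hPP).2, mul_add, add_mul, (blocks_D hPP hζ'P).2, zero_add, hc, hc0, zero_smul, zero_add,
      mul_add, add_mul, mul_smul_comm, mul_smul_comm, smul_mul_assoc, smul_mul_assoc, hQF, hFP,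
      mul_assoc (1 - P) (E * F - F * E) P, hBP, ← mul_assoc (1 - P) E F, sub_mul 1 P E, one_mul, hPE, sub_self,
      zero_mul, smul_zero, add_zero] at h
    exact (smul_eq_zero.1 h).resolve_right hF0
  rw [hc0, hc1, zero_smul, zero_smul, zero_add, zero_add] at hc
  -- `c 2 ≠ 0`
  have hc2 : c 2 ≠ 0 := by
    intro h0
    rw [h0, zero_smul] at hc
    rw [hc, add_zero] at hΘD
    -- `2P − 1 = ζ'` commutes with `E`, but `[2P − 1, E] = 2E`
    have hbr := (theta_bracket hPE hEP hPF hFP).1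
    rw [← hΘD, hζ'E, sub_self] at hbr
    exact hE0 ((smul_eq_zero.1 hbr.symm).resolve_left (two_ne_zero' ℂ))
  refine ⟨(c 2)⁻¹, -((c 2)⁻¹ • ζ'), inv_ne_zero hc2, (spanC 𝔷).neg_mem ((spanC 𝔷).smul_mem _ hζ'), ?_⟩
  have h : c 2 • (E * F - F * E) = ((2 : ℂ) • P - 1) - ζ' := by rw [← hc, ← hΘD, add_sub_cancel_left]
  have h' : (c 2)⁻¹ • (c 2 • (E * F - F * E)) = (c 2)⁻¹ • (((2 : ℂ) • P - 1) - ζ') := by rw [h]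
  rw [smul_smul, inv_mul_cancel₀ hc2, one_smul, smul_sub ((c 2)⁻¹) ((2 : ℂ) • P - 1) ζ'] at h'
  rw [h', sub_eq_add_neg]

/-- **`𝔥_ℂ = ℂ(2P − 1) + ℂE + ℂF + 𝔷_ℂ`**: every `W ∈ 𝔥_ℂ` is `c₀(2P − 1) + c₁E + c₂F + ζ` with `ζ ∈ 𝔷_ℂ` (same
hypotheses; `𝔥 = 𝔷 ⊕ 𝔡`, `𝔡_ℂ = ℂE ⊕ ℂF ⊕ ℂ[E,F]` and `[E, F] = α(2P−1) + ζ₀`). [cite: MoonenZarhin1999LowDim, §2]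
[cite: Deligne1982HodgeCycles, I §3 (3.1–3.6)] -/
theorem exists_coeffs_center_of_mem_hodgeLieC (H : HodgeStructure V n) (ψ : H.Polarization) (hn : n = 1)
    (heff : H.IsEffective) (e : Module.Basis S ℂ (ℂ ⊗[ℚ] V)) (hF : ∀ a, H.F a = Submodule.span ℂ (e '' {σ | a ≤ deg σ}))
    (hFc : ∀ a, complexConj (H.F a) = Submodule.span ℂ (e '' {σ | deg σ ≤ n - a}))
    (hdeg : ∀ σ, deg σ = 0 ∨ deg σ = 1) {X : Module.End ℚ V} (hX : X ∈ H.hodgeLie) (hXE : X ∉ H.endAlg)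
    (h3 : Module.finrank ℚ ↥(Submodule.span ℚ {B | ∃ X ∈ H.hodgeLie, ∃ Y ∈ H.hodgeLie, X * Y - Y * X = B}) = 3)
    {W : Module.End ℂ (ℂ ⊗[ℚ] V)} (hW : W ∈ H.hodgeLieC) :
    ∃ (c : Fin 3 → ℂ) (ζ : Module.End ℂ (ℂ ⊗[ℚ] V)), ζ ∈ spanC (H.hodgeLie ⊓ Subalgebra.toSubmodule H.endAlg) ∧
      W = c 0 • ((2 : ℂ) • gradingEnd e deg - 1) + c 1 • (gradingEnd e deg * X.baseChange ℂ * (1 - gradingEnd e deg)) +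
        c 2 • ((1 - gradingEnd e deg) * X.baseChange ℂ * gradingEnd e deg) + ζ := by
  classical
  subst hn
  set 𝔡 := Submodule.span ℚ {B | ∃ X ∈ H.hodgeLie, ∃ Y ∈ H.hodgeLie, X * Y - Y * X = B} with h𝔡
  set 𝔷 := H.hodgeLie ⊓ Subalgebra.toSubmodule H.endAlg with h𝔷
  obtain ⟨α, ζ₀, -, hζ₀, hEF⟩ :=
    exists_commutator_eq_of_finrank_derived_eq_three H ψ rfl heff e hF hFc hdeg hX hXE h3
  have hsum : H.hodgeLieC = spanC 𝔷 ⊔ spanC 𝔡 := by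
    rw [hodgeLieC_eq_spanC, ← spanC_sup, h𝔷, h𝔡, hodgeLie_center_sup_derived_eq H rfl heff ψ]
  rw [hsum, Submodule.mem_sup] at hW
  obtain ⟨ζ', hζ', D, hD, rfl⟩ := hW
  obtain ⟨d, hd⟩ := exists_coeffs_of_mem_spanC_derived H ψ rfl e hF hFc hdeg hX hXE h3 hD
  refine ⟨![d 2 * α, d 0, d 1], ζ' + d 2 • ζ₀, (spanC 𝔷).add_mem hζ' ((spanC 𝔷).smul_mem _ hζ₀), ?_⟩
  rw [hd, hEF]
  simp only [Matrix.cons_val_zero, Matrix.cons_val_one, Matrix.head_cons, Matrix.cons_val_two, Matrix.tail_cons,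
    smul_add, mul_smul]
  abel

/-- **Uniqueness: `c₀(2P − 1) + c₁E + c₂F + ζ = 0` with `ζ ∈ 𝔷_ℂ` forces `c₀ = c₁ = c₂ = 0` and `ζ = 0`** — the sum
`ℂ(2P−1) ⊕ ℂE ⊕ ℂF ⊕ 𝔷_ℂ` is direct (blocks; `2P − 1 ∉ 𝔷_ℂ` because `[2P − 1, E] = 2E ≠ 0`).
[cite: MoonenZarhin1999LowDim, §2] [cite: FultonHarris1991, Lecture 11 (§11.1)] -/
theorem coeffs_center_eq_zero (H : HodgeStructure V n) (hn : n = 1) (e : Module.Basis S ℂ (ℂ ⊗[ℚ] V))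
    (hF : ∀ a, H.F a = Submodule.span ℂ (e '' {σ | a ≤ deg σ}))
    (hFc : ∀ a, complexConj (H.F a) = Submodule.span ℂ (e '' {σ | deg σ ≤ n - a}))
    (hdeg : ∀ σ, deg σ = 0 ∨ deg σ = 1) {X : Module.End ℚ V} (hX : X ∈ H.hodgeLie) (hXE : X ∉ H.endAlg)
    {c : Fin 3 → ℂ} {ζ : Module.End ℂ (ℂ ⊗[ℚ] V)} (hζ : ζ ∈ spanC (H.hodgeLie ⊓ Subalgebra.toSubmodule H.endAlg))
    (h0 : c 0 • ((2 : ℂ) • gradingEnd e deg - 1) + c 1 • (gradingEnd e deg * X.baseChange ℂ * (1 - gradingEnd e deg)) +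
        c 2 • ((1 - gradingEnd e deg) * X.baseChange ℂ * gradingEnd e deg) + ζ = 0) :
    c 0 = 0 ∧ c 1 = 0 ∧ c 2 = 0 ∧ ζ = 0 := by
  classical
  subst hn
  obtain ⟨hE0, hF0⟩ := projE_ne_zero_of_not_mem_endAlg H rfl e hF hFc hdeg hXE
  set P := gradingEnd e deg with hP
  set Y := X.baseChange ℂ with hY
  set E := P * Y * (1 - P) with hEdef
  set F := (1 - P) * Y * P with hFdef
  have hPP : P * P = P := gradingEnd_mul_gradingEnd_of_deg e hdeg
  have hPE : P * E = E := by rw [hEdef, ← mul_assoc, ← mul_assoc, hPP]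
  have hEP : E * P = 0 := by rw [hEdef, mul_assoc (P * Y) (1 - P) P, sub_mul, one_mul, hPP, sub_self, mul_zero]
  have hPF : P * F = 0 := by
    rw [hFdef, mul_assoc (1 - P) Y P, ← mul_assoc P (1 - P) (Y * P), mul_sub, mul_one, hPP, sub_self, zero_mul]
  have hFP : F * P = F := by rw [hFdef, mul_assoc ((1 - P) * Y) P P, hPP]
  have hEQ : E * (1 - P) = E := by rw [mul_sub, mul_one, hEP, sub_zero]
  have hQF : (1 - P) * F = F := by rw [sub_mul, one_mul, hPF, sub_zero]
  have hYM : Y ∈ H.hodgeLieC := H.baseChange_mem_hodgeLieC hX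
  obtain ⟨hEM, -⟩ := projE_mem_hodgeLieC H e hF hFc hdeg hYM
  rw [← hP, ← hEdef] at hEM
  have hζP : ζ * P = P * ζ := commute_gradingEnd_of_mem_spanC_center H rfl e hF hFc hζ
  have hζE : ζ * E = E * ζ := commute_of_mem_spanC_center H hζ hEM
  have hc1 : c 1 = 0 := by
    have h := congrArg (fun T : Module.End ℂ (ℂ ⊗[ℚ] V) => P * T * (1 - P)) h0
    simp only [mul_add, add_mul, mul_smul_comm, smul_mul_assoc, (blocks_theta hPP).1, (blocks_D hPP hζP).1, hPE, hEQ,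
      hPF, zero_mul, mul_zero, smul_zero, add_zero, zero_add] at h
    exact (smul_eq_zero.1 h).resolve_right hE0
  have hc2 : c 2 = 0 := by
    have h := congrArg (fun T : Module.End ℂ (ℂ ⊗[ℚ] V) => (1 - P) * T * P) h0
    simp only [mul_add, add_mul, mul_smul_comm, smul_mul_assoc, (blocks_theta hPP).2, (blocks_D hPP hζP).2,
      (blocks_E hPE hEP).2, hQF, hFP, mul_zero, zero_mul, smul_zero, add_zero, zero_add] at h
    exact (smul_eq_zero.1 h).resolve_right hF0
  rw [hc1, hc2, zero_smul, zero_smul, add_zero, add_zero] at h0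
  have hc0 : c 0 = 0 := by
    by_contra hne
    -- `2P − 1 = −c₀⁻¹ ζ` commutes with `E`
    have hΘ : (2 : ℂ) • P - 1 = (-(c 0)⁻¹) • ζ := by
      have h := congrArg (fun T : Module.End ℂ (ℂ ⊗[ℚ] V) => (c 0)⁻¹ • T) h0
      simp only [smul_add, smul_smul, inv_mul_cancel₀ hne, one_smul, smul_zero] at h
      have h' := eq_neg_of_add_eq_zero_left h
      rwa [← neg_smul] at h'
    have hbr := (theta_bracket hPE hEP hPF hFP).1
    rw [hΘ, smul_mul_assoc, mul_smul_comm, hζE, sub_self] at hbr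
    exact hE0 ((smul_eq_zero.1 hbr.symm).resolve_left (two_ne_zero' ℂ))
  rw [hc0, zero_smul, zero_add] at h0
  exact ⟨hc0, hc1, hc2, h0⟩

/-! ## §3 The corners of `[E, F] = α(2P − 1) + ζ₀`: `ζ₀E = ζ₀F = 0` -/

/-- **`E F = αP + ζ₀P`, `F E = α(1−P) − ζ₀(1−P)`, `ζ₀E = 0 = ζ₀F`, `E F + F E = α + ζ₀(2P − 1)`** for an element `ζ₀`
of `𝔷_ℂ` with `[E, F] = α(2P−1) + ζ₀` (`ζ₀` commutes with `P, E, F`): the two corners of `[E, F]`, then `E F E`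
computed both ways gives `αE + ζ₀E = αE − ζ₀E`, and symmetrically for `F`.  This is the computation of the
`dim 𝔷 = 1` file `Motives/HodgeLieWeightOneRankFourSplitting` with `βφ_ℂ` replaced by `ζ₀`.
[cite: MoonenZarhin1999LowDim, §2] [cite: FultonHarris1991, Lecture 11 (§11.1)] -/
theorem corners_of_commutator_eq (H : HodgeStructure V n) (hn : n = 1) (e : Module.Basis S ℂ (ℂ ⊗[ℚ] V))
    (hF : ∀ a, H.F a = Submodule.span ℂ (e '' {σ | a ≤ deg σ}))
    (hFc : ∀ a, complexConj (H.F a) = Submodule.span ℂ (e '' {σ | deg σ ≤ n - a}))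
    (hdeg : ∀ σ, deg σ = 0 ∨ deg σ = 1) {X : Module.End ℚ V} (hX : X ∈ H.hodgeLie) {α : ℂ}
    {ζ₀ : Module.End ℂ (ℂ ⊗[ℚ] V)} (hζ₀ : ζ₀ ∈ spanC (H.hodgeLie ⊓ Subalgebra.toSubmodule H.endAlg))
    (hEF : (gradingEnd e deg * X.baseChange ℂ * (1 - gradingEnd e deg)) *
          ((1 - gradingEnd e deg) * X.baseChange ℂ * gradingEnd e deg) -
        ((1 - gradingEnd e deg) * X.baseChange ℂ * gradingEnd e deg) *
          (gradingEnd e deg * X.baseChange ℂ * (1 - gradingEnd e deg)) =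
        α • ((2 : ℂ) • gradingEnd e deg - 1) + ζ₀) :
    (gradingEnd e deg * X.baseChange ℂ * (1 - gradingEnd e deg)) *
          ((1 - gradingEnd e deg) * X.baseChange ℂ * gradingEnd e deg) = α • gradingEnd e deg + ζ₀ * gradingEnd e deg ∧
      ((1 - gradingEnd e deg) * X.baseChange ℂ * gradingEnd e deg) *
          (gradingEnd e deg * X.baseChange ℂ * (1 - gradingEnd e deg)) =
        α • (1 - gradingEnd e deg) - ζ₀ * (1 - gradingEnd e deg) ∧
      ζ₀ * (gradingEnd e deg * X.baseChange ℂ * (1 - gradingEnd e deg)) = 0 ∧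
      ζ₀ * ((1 - gradingEnd e deg) * X.baseChange ℂ * gradingEnd e deg) = 0 ∧
      (gradingEnd e deg * X.baseChange ℂ * (1 - gradingEnd e deg)) *
            ((1 - gradingEnd e deg) * X.baseChange ℂ * gradingEnd e deg) +
          ((1 - gradingEnd e deg) * X.baseChange ℂ * gradingEnd e deg) *
            (gradingEnd e deg * X.baseChange ℂ * (1 - gradingEnd e deg)) =
        α • 1 + ζ₀ * ((2 : ℂ) • gradingEnd e deg - 1) := by
  classical
  subst hn
  set P := gradingEnd e deg with hP
  set Y := X.baseChange ℂ with hY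
  set E := P * Y * (1 - P) with hEdef
  set F := (1 - P) * Y * P with hFdef
  have hPP : P * P = P := gradingEnd_mul_gradingEnd_of_deg e hdeg
  have hPE : P * E = E := by rw [hEdef, ← mul_assoc, ← mul_assoc, hPP]
  have hEP : E * P = 0 := by rw [hEdef, mul_assoc (P * Y) (1 - P) P, sub_mul, one_mul, hPP, sub_self, mul_zero]
  have hPF : P * F = 0 := by
    rw [hFdef, mul_assoc (1 - P) Y P, ← mul_assoc P (1 - P) (Y * P), mul_sub, mul_one, hPP, sub_self, zero_mul]
  have hFP : F * P = F := by rw [hFdef, mul_assoc ((1 - P) * Y) P P, hPP]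
  have hEQ : E * (1 - P) = E := by rw [mul_sub, mul_one, hEP, sub_zero]
  have hQF : (1 - P) * F = F := by rw [sub_mul, one_mul, hPF, sub_zero]
  have hYM : Y ∈ H.hodgeLieC := H.baseChange_mem_hodgeLieC hX
  obtain ⟨hEM, hFM⟩ := projE_mem_hodgeLieC H e hF hFc hdeg hYM
  rw [← hP, ← hEdef] at hEM
  rw [← hP, ← hFdef] at hFM
  have hζP : ζ₀ * P = P * ζ₀ := commute_gradingEnd_of_mem_spanC_center H rfl e hF hFc hζ₀
  have hζE : ζ₀ * E = E * ζ₀ := commute_of_mem_spanC_center H hζ₀ hEM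
  have hζF : ζ₀ * F = F * ζ₀ := commute_of_mem_spanC_center H hζ₀ hFM
  -- corners
  have hEFc : E * F = α • P + ζ₀ * P := by
    have h := (corners_comm hPE hEP hPF hFP).1
    rw [hEF, mul_add, add_mul, mul_smul_comm, smul_mul_assoc, (mul_theta hPP).1, hPP, ← hζP, mul_assoc ζ₀ P P, hPP] at h
    exact h.symm
  have hFEc : F * E = α • (1 - P) - ζ₀ * (1 - P) := by
    have h : F * E = E * F - (E * F - F * E) := by rw [sub_sub_cancel]
    rw [h, hEF, hEFc, mul_sub ζ₀ 1 P, mul_one]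
    module
  -- `E F E` and `F E F` computed both ways
  have hζE0 : ζ₀ * E = 0 := by
    have h1 : E * F * E = α • E + ζ₀ * E := by
      rw [hEFc, add_mul, smul_mul_assoc, hPE, mul_assoc ζ₀ P E, hPE]
    have h2 : E * F * E = α • E - ζ₀ * E := by
      rw [mul_assoc E F E, hFEc, mul_sub, mul_smul_comm, hEQ, ← mul_assoc E ζ₀ (1 - P), ← hζE, mul_assoc ζ₀ E (1 - P),
        hEQ]
    have h := h1.symm.trans h2
    rw [sub_eq_add_neg, add_right_inj] at h
    -- `ζ₀E = −ζ₀E`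
    have h' : (2 : ℂ) • (ζ₀ * E) = 0 := by rw [two_smul]; nth_rewrite 2 [h]; exact add_neg_cancel _
    exact (smul_eq_zero.1 h').resolve_left (two_ne_zero' ℂ)
  have hζF0 : ζ₀ * F = 0 := by
    have h1 : F * E * F = α • F - ζ₀ * F := by
      rw [hFEc, sub_mul, smul_mul_assoc, hQF, mul_assoc ζ₀ (1 - P) F, hQF]
    have h2 : F * E * F = α • F + ζ₀ * F := by
      rw [mul_assoc F E F, hEFc, mul_add, mul_smul_comm, hFP, ← mul_assoc F ζ₀ P, ← hζF, mul_assoc ζ₀ F P, hFP]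
    have h := h2.symm.trans h1
    rw [sub_eq_add_neg, add_right_inj] at h
    have h' : (2 : ℂ) • (ζ₀ * F) = 0 := by rw [two_smul]; nth_rewrite 2 [h]; exact add_neg_cancel _
    exact (smul_eq_zero.1 h').resolve_left (two_ne_zero' ℂ)
  refine ⟨hEFc, hFEc, hζE0, hζF0, ?_⟩
  rw [hEFc, hFEc, mul_sub ζ₀ _ 1, mul_one, mul_smul_comm, smul_sub, mul_sub ζ₀ 1 P, mul_one]
  module

end HodgeStructure

end Literature.AlgebraicGeometry.Motives

end
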